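import Summits.CriticalPhenomena.PercolationContinuityZ3.Theorems.Transplant.KNCells2ChainLocaliseS
import Summits.CriticalPhenomena.PercolationContinuityZ3.Theorems.Transplant.KNCells2ChainAppend
import Summits.CriticalPhenomena.PercolationContinuityZ3.Theorems.Transplant.KNCells2CorridorTwoUnit
import HarnessLib

/-!
# Residue (C) of route D″ v2, THE CORRIDOR SCHEDULE (pure `Site 2`; DPRIME-SCOPE §2 (U3′a)+(U3′b), M.5, rulings R2/R3 2026-08-21T05:09:29Z):
# localise across (`Loc.schedule`, axis `a⊥`) ∘ localise along (`Loc.schedule`, axis `a`) ∘ band run along `a` (`Band.schedule`), glued by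
# `Schedule.append` — ONE `ChainPlanar.Schedule` for the corridor chain of a probe, with its first core, last core, prism and per-phase steps read
# off, and the two-unit rooms over `PCells2`: first core `= M_x`, prism `⊆ Q_x ∪ H_{x,du}`, last core `⊆ M_{x+du} ∩ H_{x,du}`

builds on p205010 (kernel theorem, internal audit signed; external expert review pending) — nothing in this file uses p205010.
Lane `prim-bschramm`, seat `prim-bschramm-p5` (gen 6; (C) column of the D″ order of battle), helper file (`--supports stmt-CriticalPhenomena-4575 --as helper`).
PARAMETRIC in every count and extent (`N₁ N₂ N₃ ℓ₀ᵢ ℓ₁ᵢ s₁ …`): no stride or length convention is fixed here (cf. finding F-DP4-1, DPRIME-CHECKLIST DP4(iv)).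
* §0 glue `ChainPlanar.sBox_symm_sign`, `sBox_symm_swap`; §1 `Corr.CorrOK` (the three phase hypotheses + the four join equalities), `Corr.join₁/join₂`,
  **`Corr.schedule (h : CorrOK …) a hσ c : Schedule`**, `schedule_params`, `schedule_prism`, `schedule_core_zero`, `schedule_core_last`, per-phase steps
  `schedule_step₁/₂/₃` (axis, spread, region, core);
* §2 rooms: `PCells2.M_eq_sBox_symm`, **`Corr.schedule_core_zero_eq_M`**, **`Corr.schedule_prism_subset`**, `Corr.schedule_region_subset`,
  **`Corr.schedule_core_last_subset`**.
[cite: KozmaNitzan2024, §4 Lemma 12 (pp. 23–25), p. 26 (M_v, H_{v,x}), p. 31 (the corridor step)]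
-/

noncomputable section

namespace Summit.CriticalPhenomena.PercolationContinuityZ3.Theorems

namespace Transplant

namespace ChainPlanar

open Literature.Probability.Percolation Literature.Probability.LatticeModels
open Literature.Probability.Percolation.KozmaNitzan
open Literature.Probability.Percolation.KozmaNitzan.Cells (oth oth_ne eq_oth_of_ne oth_oth sgOf sgOf_sign)

/-! ## §0 Glue for symmetric signed boxes -/

/-- For SYMMETRIC level bounds the sign is immaterial: `sBox a σ c (−α) α w = sBox a 1 c (−α) α w`. [folklore] -/
theorem sBox_symm_sign {a : Fin 2} {σ : ℤ} (hσ : σ = 1 ∨ σ = -1) (c : Site 2) (α w : ℤ) : sBox a σ c (-α) α w = sBox a 1 c (-α) α w := by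
  ext y
  rw [mem_sBox_iff hσ, mem_sBox_iff (Or.inl rfl)]
  rcases hσ with rfl | rfl
  · exact Iff.rfl
  · simp only [neg_mul, one_mul, neg_le_neg_iff, neg_le]
    constructor
    · rintro ⟨⟨h1, h2⟩, h3⟩; exact ⟨⟨by linarith, by linarith⟩, h3⟩
    · rintro ⟨⟨h1, h2⟩, h3⟩; exact ⟨⟨by linarith, by linarith⟩, h3⟩

/-- **The same symmetric box on either axis**: `sBox (oth a) 1 c (−α) α w = sBox a 1 c (−w) w α`. [folklore] -/
theorem sBox_symm_swap (a : Fin 2) (c : Site 2) (α w : ℤ) : sBox (oth a) 1 c (-α) α w = sBox a 1 c (-w) w α := by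
  ext y
  rw [mem_sBox_iff (Or.inl rfl), mem_sBox_iff (Or.inl rfl)]
  simp only [one_mul]
  constructor
  · rintro ⟨⟨h1, h2⟩, h3⟩
    have ha := h3 a (oth_ne a).symm
    refine ⟨⟨by linarith [ha.1], by linarith [ha.2]⟩, fun j hj => ?_⟩
    rw [eq_oth_of_ne hj]
    exact ⟨by linarith, by linarith⟩
  · rintro ⟨⟨h1, h2⟩, h3⟩
    have ha := h3 (oth a) (oth_ne a)
    refine ⟨⟨by linarith [ha.1], by linarith [ha.2]⟩, fun j hj => ?_⟩
    have hj' : j = a := by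
      rw [eq_oth_of_ne hj, oth_oth]
    rw [hj']
    exact ⟨by linarith, by linarith⟩

/-! ## §1 The corridor schedule -/

namespace Corr

/-- **The parameter hypotheses of the corridor schedule**: phase 1 (localise across, start box `{|·_{a⊥}| ≤ L₁₀, |·_a| ≤ W₁₀}`, `N₁ + 1` rounds),
phase 2 (localise along, start box = the last box of phase 1: `L₂₀ = W₁(N₁+1)`, `W₂₀ = L₁(N₁+1)`, `N₂ + 1` rounds), phase 3 (band run along `a`
from the start box `{|·_a| ≤ q, |·_{a⊥}| ≤ q'}` = the last box of phase 2, `N₃ + 1` steps of spacing `s₁`, extents `≤ ℓ₁₃`); one radius `R'`.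
[cite: KozmaNitzan2024, §4 Lemma 12 (pp. 23–25)] -/
structure CorrOK (L₁₀ W₁₀ L₂₀ W₂₀ q q' s₁ ρ : ℤ) (R' ℓ₀₁ ℓ₁₁ WM₁ N₁ ℓ₀₂ ℓ₁₂ WM₂ N₂ ℓ₀₃ N₃ WM₃ ℓ₁₃ : ℕ) (Wb₁ Wb₂ Wb₃ : ℕ → ℕ) : Prop where
  /-- phase 1 is a localisation schedule -/
  loc₁ : Loc.LocOK L₁₀ W₁₀ R' ℓ₀₁ ℓ₁₁ WM₁ Wb₁
  /-- phase 2 is a localisation schedule -/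
  loc₂ : Loc.LocOK L₂₀ W₂₀ R' ℓ₀₂ ℓ₁₂ WM₂ Wb₂
  /-- phase 3 is a band run -/
  band : Band.BandOK q q' s₁ ρ R' ℓ₀₃ N₃ WM₃ Wb₃
  /-- the band's extents are certified up to `ℓ₁₃` -/
  hℓ₁₃ : 2 * q + s₁ + R' ≤ (ℓ₁₃ : ℤ)
  /-- join 1: the along-width of phase 2 starts at the transverse width phase 1 ends with -/
  hL₂ : L₂₀ = Loc.W W₁₀ R' WM₁ (N₁ + 1)
  /-- join 1: the transverse width of phase 2 starts at the along-width phase 1 ends with -/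
  hW₂ : W₂₀ = Loc.L L₁₀ R' ℓ₀₁ ℓ₁₁ (N₁ + 1)
  /-- join 2: the band's start half-length is the along-width phase 2 ends with -/
  hq : q = Loc.L L₂₀ R' ℓ₀₂ ℓ₁₂ (N₂ + 1)
  /-- join 2: the band's start half-width is the transverse width phase 2 ends with -/
  hq' : q' = Loc.W W₂₀ R' WM₂ (N₂ + 1)

variable {L₁₀ W₁₀ L₂₀ W₂₀ q q' s₁ ρ : ℤ} {R' ℓ₀₁ ℓ₁₁ WM₁ N₁ ℓ₀₂ ℓ₁₂ WM₂ N₂ ℓ₀₃ N₃ WM₃ ℓ₁₃ : ℕ} {Wb₁ Wb₂ Wb₃ : ℕ → ℕ}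
  (h : CorrOK L₁₀ W₁₀ L₂₀ W₂₀ q q' s₁ ρ R' ℓ₀₁ ℓ₁₁ WM₁ N₁ ℓ₀₂ ℓ₁₂ WM₂ N₂ ℓ₀₃ N₃ WM₃ ℓ₁₃ Wb₁ Wb₂ Wb₃)
  (a : Fin 2) {σ : ℤ} (hσ : σ = 1 ∨ σ = -1) (c : Site 2)

/-- **Join 1**: the first core of phase 2 is the last core of phase 1. [folklore] -/
theorem join₁ : (Loc.schedule h.loc₂ a c N₂).core 0 = (Loc.schedule h.loc₁ (oth a) c N₁).core ((Loc.schedule h.loc₁ (oth a) c N₁).N + 1) := by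
  rw [Loc.schedule_core, Loc.schedule_core, (Loc.schedule_params h.loc₁ (oth a) c N₁).1, Loc.core, Loc.core, Loc.L_zero, Loc.W_zero, h.hL₂,
    h.hW₂, sBox_symm_swap]

/-- The first two phases appended. [folklore] -/
def loc₁₂ : Schedule := (Loc.schedule h.loc₁ (oth a) c N₁).append (Loc.schedule h.loc₂ a c N₂) rfl (join₁ h a c)

/-- **Join 2**: the first core of the band run is the last core of phase 2. [folklore] -/
theorem join₂ : (Band.schedule a hσ c h.band h.hℓ₁₃).core 0 = (loc₁₂ h a c).core ((loc₁₂ h a c).N + 1) := by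
  rw [loc₁₂, Schedule.append_core_last, (Band.schedule_core_zero a hσ c h.band h.hℓ₁₃).1, Loc.schedule_core,
    (Loc.schedule_params h.loc₂ a c N₂).1, Loc.core, ← h.hq, ← h.hq', sBox_symm_sign hσ]

/-- **THE CORRIDOR SCHEDULE**: localise across (axis `a⊥`, `N₁ + 1` rounds), localise along (axis `a`, `N₂ + 1` rounds), band run along `a` with
sign `σ` (`N₃ + 1` steps), all about the centre `c`. [cite: KozmaNitzan2024, §4 Lemma 12 (pp. 23–25)] -/
def schedule : Schedule := (loc₁₂ h a c).append (Band.schedule a hσ c h.band h.hℓ₁₃) rfl (join₂ h a hσ c)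

/-- The parameters of the corridor schedule: `N + 1 = (N₁+1) + (N₂+1) + (N₃+1)` steps, radius `R'`, extents `[min ℓ₀ᵢ, max ℓ₁ᵢ]`. [folklore] -/
theorem schedule_params : (schedule h a hσ c).N = N₁ + 1 + N₂ + 1 + N₃ ∧ (schedule h a hσ c).R' = R' ∧
    (schedule h a hσ c).ℓ₀ = min (min ℓ₀₁ ℓ₀₂) ℓ₀₃ ∧ (schedule h a hσ c).ℓ₁ = max (max ℓ₁₁ ℓ₁₂) ℓ₁₃ :=
  ⟨rfl, rfl, rfl, rfl⟩

/-- **The prism of the corridor schedule**: the two localisation regions and the band prism. [folklore] -/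
theorem schedule_prism : (schedule h a hσ c).prism =
    (Loc.region L₁₀ W₁₀ R' ℓ₀₁ ℓ₁₁ WM₁ (oth a) c (N₁ + 1) ∪ Loc.region L₂₀ W₂₀ R' ℓ₀₂ ℓ₁₂ WM₂ a c (N₂ + 1)) ∪
      sBox a σ c (-ρ) (q + ((N₃ : ℤ) + 1) * s₁) ρ := rfl

/-- **The first core of the corridor schedule is the start box** `{|·_{a⊥} − c_{a⊥}| ≤ L₁₀, |·_a − c_a| ≤ W₁₀}`. [folklore] -/
theorem schedule_core_zero : (schedule h a hσ c).core 0 = sBox (oth a) 1 c (-L₁₀) L₁₀ W₁₀ := by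
  rw [schedule, Schedule.append_core_zero, loc₁₂, Schedule.append_core_zero, Loc.schedule_core_zero]

/-- **The last core of the corridor schedule is the far line core of the band** `{·_a − c_a = σ (q + (N₃+1) s₁), |·_{a⊥} − c_{a⊥}| ≤ w₁ + N₃ R'}`.
[folklore] -/
theorem schedule_core_last : (schedule h a hσ c).core ((schedule h a hσ c).N + 1) =
    sBox a σ c (q + ((N₃ : ℤ) + 1) * s₁) (q + ((N₃ : ℤ) + 1) * s₁) (Band.w₁ q' R' WM₃ + (N₃ : ℤ) * R') := by
  rw [schedule, Schedule.append_core_last, (Band.schedule_params a hσ c h.band h.hℓ₁₃).1, (Band.schedule_core_last a hσ c h.band h.hℓ₁₃).1]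

/-- **Phase 1 steps** (`k ≤ N₁`): axis `a⊥`, spread `Wb₁`, region `Loc.region … (oth a) c (N₁+1)`, core `Loc.core … (oth a) c k`. [folklore] -/
theorem schedule_step₁ {k : ℕ} (hk : k ≤ N₁) : (schedule h a hσ c).ax k = oth a ∧ (schedule h a hσ c).Wb k = Wb₁ ∧
    (schedule h a hσ c).region k = Loc.region L₁₀ W₁₀ R' ℓ₀₁ ℓ₁₁ WM₁ (oth a) c (N₁ + 1) ∧
    (schedule h a hσ c).core k = Loc.core L₁₀ W₁₀ R' ℓ₀₁ ℓ₁₁ WM₁ (oth a) c k := by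
  have hk' : k ≤ (loc₁₂ h a c).N := by show k ≤ N₁ + 1 + N₂; omega
  refine ⟨?_, ?_, ?_, ?_⟩
  · rw [schedule, Schedule.append_ax_left _ _ _ _ hk', loc₁₂, Schedule.append_ax_left _ _ _ _ hk, Loc.schedule_ax]
  · rw [schedule, Schedule.append_Wb_left _ _ _ _ hk', loc₁₂, Schedule.append_Wb_left _ _ _ _ hk, Loc.schedule_Wb]
  · rw [schedule, Schedule.append_region_left _ _ _ _ hk', loc₁₂, Schedule.append_region_left _ _ _ _ hk, Loc.schedule_region]
  · rw [schedule, Schedule.append_core_left _ _ _ _ hk', loc₁₂, Schedule.append_core_left _ _ _ _ hk, Loc.schedule_core]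

/-- **Phase 2 steps** (`N₁ + 1 + j`, `j ≤ N₂`): axis `a`, spread `Wb₂`, region `Loc.region … a c (N₂+1)`, core `Loc.core … a c j`. [folklore] -/
theorem schedule_step₂ {j : ℕ} (hj : j ≤ N₂) : (schedule h a hσ c).ax (N₁ + 1 + j) = a ∧ (schedule h a hσ c).Wb (N₁ + 1 + j) = Wb₂ ∧
    (schedule h a hσ c).region (N₁ + 1 + j) = Loc.region L₂₀ W₂₀ R' ℓ₀₂ ℓ₁₂ WM₂ a c (N₂ + 1) ∧
    (schedule h a hσ c).core (N₁ + 1 + j) = Loc.core L₂₀ W₂₀ R' ℓ₀₂ ℓ₁₂ WM₂ a c j := by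
  have hk' : N₁ + 1 + j ≤ (loc₁₂ h a c).N := by show N₁ + 1 + j ≤ N₁ + 1 + N₂; omega
  refine ⟨?_, ?_, ?_, ?_⟩
  · rw [schedule, Schedule.append_ax_left _ _ _ _ hk', loc₁₂]
    exact (Schedule.append_ax_right _ _ _ _ j).trans (Loc.schedule_ax _ _ _ _ _)
  · rw [schedule, Schedule.append_Wb_left _ _ _ _ hk', loc₁₂]
    exact (Schedule.append_Wb_right _ _ _ _ j).trans (Loc.schedule_Wb _ _ _ _ _)
  · rw [schedule, Schedule.append_region_left _ _ _ _ hk', loc₁₂]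
    exact (Schedule.append_region_right _ _ _ _ j).trans (Loc.schedule_region _ _ _ _ _)
  · rw [schedule, Schedule.append_core_left _ _ _ _ hk', loc₁₂]
    exact (Schedule.append_core_right _ _ _ _ j).trans (Loc.schedule_core _ _ _ _ _)

/-- **Phase 3 steps** (`N₁ + 1 + N₂ + 1 + j`): axis `a`, spread `Wb₃`, region `Band.region q s₁ ρ a σ c j`, core `Band.core q q' s₁ R' WM₃ a σ c j`.
[folklore] -/
theorem schedule_step₃ (j : ℕ) : (schedule h a hσ c).ax (N₁ + 1 + N₂ + 1 + j) = a ∧ (schedule h a hσ c).Wb (N₁ + 1 + N₂ + 1 + j) = Wb₃ ∧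
    (schedule h a hσ c).region (N₁ + 1 + N₂ + 1 + j) = Band.region q s₁ ρ a σ c j ∧
    (schedule h a hσ c).core (N₁ + 1 + N₂ + 1 + j) = Band.core q q' s₁ R' WM₃ a σ c j := by
  refine ⟨?_, ?_, ?_, ?_⟩
  · rw [schedule]
    exact (Schedule.append_ax_right _ _ _ _ j).trans (Band.schedule_ax _ _ _ _ _ _)
  · rw [schedule]
    exact (Schedule.append_Wb_right _ _ _ _ j).trans (Band.schedule_Wb _ _ _ _ _ _)
  · rw [schedule]
    exact (Schedule.append_region_right _ _ _ _ j).trans (congrFun (Band.schedule_region a hσ c h.band h.hℓ₁₃) j)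
  · rw [schedule]
    exact (Schedule.append_core_right _ _ _ _ j).trans (Band.schedule_core _ _ _ _ _ _)

/-- Every region of the corridor schedule lies in its prism. [folklore] -/
theorem schedule_region_subset_prism {k : ℕ} (hk : k ≤ (schedule h a hσ c).N) : (schedule h a hσ c).region k ⊆
    (Loc.region L₁₀ W₁₀ R' ℓ₀₁ ℓ₁₁ WM₁ (oth a) c (N₁ + 1) ∪ Loc.region L₂₀ W₂₀ R' ℓ₀₂ ℓ₁₂ WM₂ a c (N₂ + 1)) ∪
      sBox a σ c (-ρ) (q + ((N₃ : ℤ) + 1) * s₁) ρ :=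
  (schedule h a hσ c).sub_prism k hk

end Corr

end ChainPlanar

/-! ## §2 The two-unit rooms of the corridor schedule -/

namespace PCells2

open Literature.Probability.Percolation Literature.Probability.LatticeModels
open Literature.Probability.Percolation.KozmaNitzan
open Literature.Probability.Percolation.KozmaNitzan.Cells (oth oth_ne eq_oth_of_ne oth_oth sgOf sgOf_sign)

/-- **The arrival box as a symmetric signed box on either axis**: `M_x = {|·_a − cen_a| ≤ 3 r_a, |·_{a⊥} − cen_{a⊥}| ≤ 3 r_{a⊥}}`.
[cite: KozmaNitzan2024, §4 p. 26 (M_v)] -/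
theorem M_eq_sBox_symm (P : PCells2) (x : Site 2) (a : Fin 2) :
    P.M x = sBox a 1 (P.cen x) (-(3 * (P.r a : ℤ))) (3 * (P.r a : ℤ)) (3 * (P.r (oth a) : ℤ)) := by
  ext y
  rw [PCells2.M, P.mem_abox_iff, mem_sBox_iff (Or.inl rfl)]
  simp only [one_mul]
  constructor
  · intro hy
    refine ⟨?_, fun j hj => ?_⟩
    · have := hy a
      push_cast at this
      exact ⟨by linarith [this.1], by linarith [this.2]⟩
    · have := hy j
      rw [eq_oth_of_ne hj] at this ⊢
      push_cast at this
      exact ⟨by linarith [this.1], by linarith [this.2]⟩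
  · rintro ⟨h1, hj⟩ i
    by_cases hi : i = a
    · subst hi
      push_cast
      exact ⟨by linarith [h1.1], by linarith [h1.2]⟩
    · have := hj i hi
      have hri : P.r (oth a) = P.r i := by rw [← eq_oth_of_ne hi]
      rw [hri] at this
      push_cast
      exact ⟨by linarith [this.1], by linarith [this.2]⟩

end PCells2

namespace ChainPlanar

namespace Corr

open Literature.Probability.Percolation Literature.Probability.LatticeModels
open Literature.Probability.Percolation.KozmaNitzan
open Literature.Probability.Percolation.KozmaNitzan.Cells (oth oth_ne eq_oth_of_ne oth_oth sgOf sgOf_sign)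

variable (P : PCells2) (x : Site 2) (du : MDir)
  {L₁₀ W₁₀ L₂₀ W₂₀ q q' s₁ ρ : ℤ} {R' ℓ₀₁ ℓ₁₁ WM₁ N₁ ℓ₀₂ ℓ₁₂ WM₂ N₂ ℓ₀₃ N₃ WM₃ ℓ₁₃ : ℕ} {Wb₁ Wb₂ Wb₃ : ℕ → ℕ}
  (h : CorrOK L₁₀ W₁₀ L₂₀ W₂₀ q q' s₁ ρ R' ℓ₀₁ ℓ₁₁ WM₁ N₁ ℓ₀₂ ℓ₁₂ WM₂ N₂ ℓ₀₃ N₃ WM₃ ℓ₁₃ Wb₁ Wb₂ Wb₃)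

/-- **The corridor schedule of the probe `(x, du)` starts at the arrival box**: with `L₁₀ = 3 r⊥`, `W₁₀ = 3 r∥` its first core IS `M_x`.
[cite: KozmaNitzan2024, §4 Lemma 12 (pp. 23–25), p. 26 (M_v)] -/
theorem schedule_core_zero_eq_M (hL : L₁₀ = 3 * (P.r (oth du.1) : ℤ)) (hW : W₁₀ = 3 * (P.r du.1 : ℤ)) :
    (schedule h du.1 (sgOf_sign du) (P.cen x)).core 0 = P.M x := by
  rw [schedule_core_zero, hL, hW, P.M_eq_sBox_symm x (oth du.1), oth_oth]

/-- **The prism of the corridor schedule lies in `Q_x ∪ H_{x,du}`** under the two-unit rooms: localisation regions inside the cube box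
(`max L₁₀ ℓ₀₁ + R' + ℓ₁₁ ≤ 5 r⊥`, `W₁(N₁+1) + R' + WM₁ ≤ 5 r∥`, `max L₂₀ ℓ₀₂ + R' + ℓ₁₂ ≤ 5 r∥`, `W₂(N₂+1) + R' + WM₂ ≤ 5 r⊥`), band prism inside
cube ∪ corridor (`ρ ≤ 5 r∥`, `ρ ≤ 2 r⊥`, `q + (N₃+1) s₁ ≤ 22 r∥`). [cite: KozmaNitzan2024, §4 Lemma 12 (pp. 23–25), p. 26] -/
theorem schedule_prism_subset
    (h₁L : max L₁₀ (ℓ₀₁ : ℤ) + R' + ℓ₁₁ ≤ 5 * (P.r (oth du.1) : ℤ)) (h₁W : Loc.W W₁₀ R' WM₁ (N₁ + 1) + R' + WM₁ ≤ 5 * (P.r du.1 : ℤ))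
    (h₂L : max L₂₀ (ℓ₀₂ : ℤ) + R' + ℓ₁₂ ≤ 5 * (P.r du.1 : ℤ)) (h₂W : Loc.W W₂₀ R' WM₂ (N₂ + 1) + R' + WM₂ ≤ 5 * (P.r (oth du.1) : ℤ))
    (hρ₁ : ρ ≤ 5 * (P.r du.1 : ℤ)) (hρ₂ : ρ ≤ 2 * (P.r (oth du.1) : ℤ)) (hfar : q + ((N₃ : ℤ) + 1) * s₁ ≤ 22 * (P.r du.1 : ℤ)) :
    (schedule h du.1 (sgOf_sign du) (P.cen x)).prism ⊆ P.Q x ∪ P.Hfull x du := by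
  rw [schedule_prism]
  refine Finset.union_subset (Finset.union_subset ?_ ?_) ?_
  · refine subset_trans ?_ Finset.subset_union_left
    rw [Loc.region]
    refine P.sBox_symm_subset_Q x (oth du.1) h₁L ?_
    rw [oth_oth]; exact h₁W
  · refine subset_trans ?_ Finset.subset_union_left
    rw [Loc.region]
    exact P.sBox_symm_subset_Q x du.1 h₂L h₂W
  · exact P.sBox_subset_Q_union_Hfull x du (by linarith) hfar hρ₂

/-- **Every region of the corridor schedule lies in `Q_x ∪ H_{x,du}`** (same rooms). [folklore] -/
theorem schedule_region_subset
    (h₁L : max L₁₀ (ℓ₀₁ : ℤ) + R' + ℓ₁₁ ≤ 5 * (P.r (oth du.1) : ℤ)) (h₁W : Loc.W W₁₀ R' WM₁ (N₁ + 1) + R' + WM₁ ≤ 5 * (P.r du.1 : ℤ))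
    (h₂L : max L₂₀ (ℓ₀₂ : ℤ) + R' + ℓ₁₂ ≤ 5 * (P.r du.1 : ℤ)) (h₂W : Loc.W W₂₀ R' WM₂ (N₂ + 1) + R' + WM₂ ≤ 5 * (P.r (oth du.1) : ℤ))
    (hρ₁ : ρ ≤ 5 * (P.r du.1 : ℤ)) (hρ₂ : ρ ≤ 2 * (P.r (oth du.1) : ℤ)) (hfar : q + ((N₃ : ℤ) + 1) * s₁ ≤ 22 * (P.r du.1 : ℤ))
    {k : ℕ} (hk : k ≤ (schedule h du.1 (sgOf_sign du) (P.cen x)).N) :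
    (schedule h du.1 (sgOf_sign du) (P.cen x)).region k ⊆ P.Q x ∪ P.Hfull x du :=
  ((schedule h du.1 (sgOf_sign du) (P.cen x)).sub_prism k hk).trans (schedule_prism_subset P x du h h₁L h₁W h₂L h₂W hρ₁ hρ₂ hfar)

/-- **The last core of the corridor schedule enters the arrival box of the next cell**: with the far line in `[17 r∥, 22 r∥]` and the last
half-width `w₁ + N₃ R' ≤ 2 r⊥` it lies in `M_{x+du} ∩ H_{x,du}`. [cite: KozmaNitzan2024, §4 Lemma 12 (pp. 23–25: the run ends in the target box)] -/
theorem schedule_core_last_subset (h17 : 17 * (P.r du.1 : ℤ) ≤ q + ((N₃ : ℤ) + 1) * s₁) (h22 : q + ((N₃ : ℤ) + 1) * s₁ ≤ 22 * (P.r du.1 : ℤ))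
    (hw : Band.w₁ q' R' WM₃ + (N₃ : ℤ) * R' ≤ 2 * (P.r (oth du.1) : ℤ)) :
    (schedule h du.1 (sgOf_sign du) (P.cen x)).core ((schedule h du.1 (sgOf_sign du) (P.cen x)).N + 1) ⊆ P.M (x + stepVec du) ∩ P.Hfull x du := by
  rw [schedule_core_last]
  exact P.sBox_subset_M_add_inter_Hfull x du h17 h22 hw

end Corr

end ChainPlanar

end Transplant

end Summit.CriticalPhenomena.PercolationContinuityZ3.Theorems

end
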